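import Mathlib

/-!
# PercRepro — the arithmetic of the arc case of the rigid cell (night-2, gen 18)

`proofs/NIGHT-2-g18.md` §3: for the rigid cell `(|E ∖ G|, kColoops) = (q−1, q−2)` whose plane `V = G ∖ K` is an
`n`-arc (`U_{3,n}`, `n ≥ 5`), the fair-share certificate with `π = dem / #supSets` reduces the local form (LI_G) to
the explicit inequality

  `arcR n q ≤ arcL n q`,   `arcL n q = (2/(n(n−1))) · (c · arcA n + n + 1)`,   `arcR n q = Φ (n−2)/(n+q−3)`,

with `c = (q+4)/(q(q+1))` the minimal residual capacity, `Φ = (q+2)/(q+1)`, and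
`arcA n = 2^n − 2n − 2 − n(n−1)/2 = Σ_{3 ≤ j ≤ n−2} C(n, j)` the number of spanning subsets of the arc with at
least two points missing.  **`arc_ineq`** proves it for every `n ≥ 5` and every `q ≥ 4`: for `n ≥ 8` through
`arcA n ≥ (3/5) n (n−1)(n−2)` (`arcA_ge`, induction on the recursion `arcA (n+1) = 2 arcA n + n(n+1)/2`) and
`c ≥ 1/(q+1)`; for `n = 5, 6, 7` through three positive polynomials in `q`.
-/

namespace PercRepro.Shadow.Arc

/-- `arcA n = 2^n − 2n − 2 − n(n−1)/2`. -/
def arcA (n : ℕ) : ℚ := (2 : ℚ) ^ n - 2 * (n : ℚ) - 2 - (n : ℚ) * ((n : ℚ) - 1) / 2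

/-- The left side of the arc inequality. -/
def arcL (n q : ℕ) : ℚ :=
  (2 / ((n : ℚ) * ((n : ℚ) - 1))) * ((((q : ℚ) + 4) / ((q : ℚ) * ((q : ℚ) + 1))) * arcA n + (n : ℚ) + 1)

/-- The right side of the arc inequality: `Φ (n−2)/(n+q−3)`. -/
def arcR (n q : ℕ) : ℚ := (((q : ℚ) + 2) / ((q : ℚ) + 1)) * ((n : ℚ) - 2) / ((n : ℚ) + (q : ℚ) - 3)

/-- The recursion `arcA (n+1) = 2 arcA n + n(n+1)/2`. -/
theorem arcA_succ (n : ℕ) : arcA (n + 1) = 2 * arcA n + (n : ℚ) * ((n : ℚ) + 1) / 2 := by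
  unfold arcA
  push_cast
  ring

/-- `arcA 8 = 210`. -/
theorem arcA_eight : arcA 8 = 210 := by
  unfold arcA; norm_num

/-- `arcA n ≥ (3/5) n (n−1)(n−2)` for `n ≥ 8`. -/
theorem arcA_ge {n : ℕ} (hn : 8 ≤ n) :
    (3 / 5 : ℚ) * (n : ℚ) * ((n : ℚ) - 1) * ((n : ℚ) - 2) ≤ arcA n := by
  induction n, hn using Nat.le_induction with
  | base => rw [arcA_eight]; norm_num
  | succ m hm ih =>
    rw [arcA_succ]
    push_cast
    have hm' : (8 : ℚ) ≤ (m : ℚ) := by exact_mod_cast hm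
    have hprod : (0 : ℚ) ≤ (m : ℚ) * ((m : ℚ) - 1) * ((m : ℚ) - 5) :=
      mul_nonneg (mul_nonneg (by linarith) (by linarith)) (by linarith)
    nlinarith [ih, hm', hprod]

/-- `arcA n ≥ 0` for `n ≥ 5`. -/
theorem arcA_nonneg {n : ℕ} (hn : 5 ≤ n) : 0 ≤ arcA n := by
  induction n, hn using Nat.le_induction with
  | base => unfold arcA; norm_num
  | succ m hm ih =>
    rw [arcA_succ]
    have hm' : (5 : ℚ) ≤ (m : ℚ) := by exact_mod_cast hm
    nlinarith [ih, hm']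

/-- The arc inequality for `n ≥ 8`. -/
theorem arc_ineq_large {n q : ℕ} (hn : 8 ≤ n) (hq : 4 ≤ q) : arcR n q ≤ arcL n q := by
  have hnq : (8 : ℚ) ≤ (n : ℚ) := by exact_mod_cast hn
  have hqq : (4 : ℚ) ≤ (q : ℚ) := by exact_mod_cast hq
  have hA := arcA_ge hn
  unfold arcL arcR
  -- arcL ≥ (2/(n(n−1))) · c · arcA n ≥ (6/5)(n−2)/(q+1) ≥ arcR
  have hc : (1 : ℚ) / ((q : ℚ) + 1) ≤ ((q : ℚ) + 4) / ((q : ℚ) * ((q : ℚ) + 1)) := by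
    rw [div_le_div_iff₀ (by positivity) (by positivity)]
    nlinarith
  have hnn : (0 : ℚ) < (n : ℚ) * ((n : ℚ) - 1) := by nlinarith
  have hden : (0 : ℚ) < (n : ℚ) + (q : ℚ) - 3 := by linarith
  have hq1 : (0 : ℚ) < (q : ℚ) + 1 := by linarith
  -- step 1: arcL ≥ (2/(n(n−1))) * (1/(q+1)) * arcA n
  have h1 : (2 / ((n : ℚ) * ((n : ℚ) - 1))) * ((1 / ((q : ℚ) + 1)) * arcA n) ≤
      (2 / ((n : ℚ) * ((n : ℚ) - 1))) * ((((q : ℚ) + 4) / ((q : ℚ) * ((q : ℚ) + 1))) * arcA n + (n : ℚ) + 1) := by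
    apply mul_le_mul_of_nonneg_left _ (by positivity)
    have hA0 : 0 ≤ arcA n := arcA_nonneg (by omega)
    nlinarith [mul_le_mul_of_nonneg_right hc hA0]
  -- step 2: (2/(n(n−1))) * (1/(q+1)) * arcA n ≥ (6/5)(n−2)/(q+1)
  have h2 : (6 / 5 : ℚ) * ((n : ℚ) - 2) / ((q : ℚ) + 1) ≤
      (2 / ((n : ℚ) * ((n : ℚ) - 1))) * ((1 / ((q : ℚ) + 1)) * arcA n) := by
    rw [show (2 / ((n : ℚ) * ((n : ℚ) - 1))) * ((1 / ((q : ℚ) + 1)) * arcA n) =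
        (2 * arcA n / ((n : ℚ) * ((n : ℚ) - 1))) / ((q : ℚ) + 1) by ring]
    apply div_le_div_of_nonneg_right _ hq1.le
    rw [le_div_iff₀ hnn]
    nlinarith [hA]
  -- step 3: arcR ≤ (6/5)(n−2)/(q+1)
  have h3 : (((q : ℚ) + 2) / ((q : ℚ) + 1)) * ((n : ℚ) - 2) / ((n : ℚ) + (q : ℚ) - 3) ≤
      (6 / 5 : ℚ) * ((n : ℚ) - 2) / ((q : ℚ) + 1) := by
    rw [div_le_div_iff₀ hden hq1]
    have hΦ : ((q : ℚ) + 2) / ((q : ℚ) + 1) ≤ 6 / 5 := by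
      rw [div_le_div_iff₀ hq1 (by norm_num)]; linarith
    have hn2 : (0 : ℚ) ≤ (n : ℚ) - 2 := by linarith
    have hqn : (q : ℚ) + 1 ≤ (n : ℚ) + (q : ℚ) - 3 := by linarith
    calc ((q : ℚ) + 2) / ((q : ℚ) + 1) * ((n : ℚ) - 2) * ((q : ℚ) + 1)
        ≤ 6 / 5 * ((n : ℚ) - 2) * ((q : ℚ) + 1) := by
          apply mul_le_mul_of_nonneg_right _ hq1.le
          exact mul_le_mul_of_nonneg_right hΦ hn2
      _ ≤ 6 / 5 * ((n : ℚ) - 2) * ((n : ℚ) + (q : ℚ) - 3) := by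
          apply mul_le_mul_of_nonneg_left hqn
          positivity
  exact h3.trans (h2.trans h1)

/-- `n = 5`: `arcL − arcR = (3q² − 7q + 20)/(5q(q+1))`. -/
theorem arcL_sub_arcR_five {q : ℕ} (hq : 4 ≤ q) :
    arcL 5 q - arcR 5 q = (3 * (q : ℚ) ^ 2 - 7 * (q : ℚ) + 20) / (5 * (q : ℚ) * ((q : ℚ) + 1)) := by
  have hq0 : (q : ℚ) ≠ 0 := by exact_mod_cast (by omega : q ≠ 0)
  have hq1 : (q : ℚ) + 1 ≠ 0 := by positivity
  have hq2 : (5 : ℚ) + (q : ℚ) - 3 ≠ 0 := by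
    have : (4 : ℚ) ≤ (q : ℚ) := by exact_mod_cast hq
    intro h; linarith
  have hq2'' : (q : ℚ) + 2 ≠ 0 := by positivity
  unfold arcL arcR arcA
  push_cast
  rw [show (5 : ℚ) + (q : ℚ) - 3 = (q : ℚ) + 2 by ring]
  field_simp
  ring

/-- `n = 6`: `arcL − arcR = (7q³ + 3q² + 146q + 420)/(15q(q+1)(q+3))`. -/
theorem arcL_sub_arcR_six {q : ℕ} (hq : 4 ≤ q) :
    arcL 6 q - arcR 6 q =
      (7 * (q : ℚ) ^ 3 + 3 * (q : ℚ) ^ 2 + 146 * (q : ℚ) + 420) /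
        (15 * (q : ℚ) * ((q : ℚ) + 1) * ((q : ℚ) + 3)) := by
  have hq0 : (q : ℚ) ≠ 0 := by exact_mod_cast (by omega : q ≠ 0)
  have hq1 : (q : ℚ) + 1 ≠ 0 := by positivity
  have hq3 : (q : ℚ) + 3 ≠ 0 := by positivity
  have hq2 : (6 : ℚ) + (q : ℚ) - 3 ≠ 0 := by
    have : (4 : ℚ) ≤ (q : ℚ) := by exact_mod_cast hq
    intro h; linarith
  have hq2'' : (q : ℚ) + 3 ≠ 0 := by positivity
  unfold arcL arcR arcA
  push_cast
  rw [show (6 : ℚ) + (q : ℚ) - 3 = (q : ℚ) + 3 by ring]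
  field_simp
  ring

/-- `n = 7`: `arcL − arcR = (8q³ + 26q² + 550q + 1456)/(21q(q+1)(q+4))`. -/
theorem arcL_sub_arcR_seven {q : ℕ} (hq : 4 ≤ q) :
    arcL 7 q - arcR 7 q =
      (8 * (q : ℚ) ^ 3 + 26 * (q : ℚ) ^ 2 + 550 * (q : ℚ) + 1456) /
        (21 * (q : ℚ) * ((q : ℚ) + 1) * ((q : ℚ) + 4)) := by
  have hq0 : (q : ℚ) ≠ 0 := by exact_mod_cast (by omega : q ≠ 0)
  have hq1 : (q : ℚ) + 1 ≠ 0 := by positivity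
  have hq4 : (q : ℚ) + 4 ≠ 0 := by positivity
  have hq2 : (7 : ℚ) + (q : ℚ) - 3 ≠ 0 := by
    have : (4 : ℚ) ≤ (q : ℚ) := by exact_mod_cast hq
    intro h; linarith
  have hq2'' : (q : ℚ) + 4 ≠ 0 := by positivity
  unfold arcL arcR arcA
  push_cast
  rw [show (7 : ℚ) + (q : ℚ) - 3 = (q : ℚ) + 4 by ring]
  field_simp
  ring

/-- **The arc inequality** `(★)`: `arcR n q ≤ arcL n q` for every `n ≥ 5` and `q ≥ 4`. -/
theorem arc_ineq {n q : ℕ} (hn : 5 ≤ n) (hq : 4 ≤ q) : arcR n q ≤ arcL n q := by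
  have hqq : (4 : ℚ) ≤ (q : ℚ) := by exact_mod_cast hq
  rcases (by omega : n = 5 ∨ n = 6 ∨ n = 7 ∨ 8 ≤ n) with rfl | rfl | rfl | h8
  · rw [← sub_nonneg, arcL_sub_arcR_five hq]
    apply div_nonneg _ (by positivity)
    nlinarith
  · rw [← sub_nonneg, arcL_sub_arcR_six hq]
    apply div_nonneg _ (by positivity)
    nlinarith
  · rw [← sub_nonneg, arcL_sub_arcR_seven hq]
    apply div_nonneg _ (by positivity)
    nlinarith
  · exact arc_ineq_large h8 hq

end PercRepro.Shadow.Arc
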